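import Mathlib
import Literature.Analysis.FluidPDE.FiniteFourierModeEuler
import Literature.Analysis.ODE.ComplexSecondOrder
import HarnessLib

/-!
# Census row A1F — part 1/2: the finite-mode Fourier-side Navier–Stokes class, the row, S1 «the Euler interaction does no work»

Re-homed for the scenario census (typer seat ns-census-typer-1 g5; lead g7 MINT INTENT A1F 2026-08-28T16:20Z / ACK REV 5 16:46Z,
GO 16:49Z «A1F port: bohr-meter REV 5 block freqSq :117 … row_A1F_holds :488») from ns-idea-2 g10's LINE «bohr-meter» REV 5
(`pub/ideators/ns-idea-2/lines/bohr-meter/line-bohr-meter.lean`, sha16 38276969af99c456; ref g7 PRE-CHECK ✓ 16:24Z / 16:47Z;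
critic RE-STAMP CONFORMS 16:43Z; lit LABEL 16:23Z: one-line corollary of Kishimoto–Yoneda, JMFM 2022, Thm 5.1, not verbatim in
print), in two files for the 400-line rule: `ScenarioCensusRowA1FModes` (the class, the row, S1 `FourierEnergyNull` PROVED) →
`ScenarioCensusRowA1F` (the energy argument `row_A1F_of_stubs`, `row_A1F_holds`, census keys).  Lean text of the A1F block verbatim
in namespace `…Theorems.ScenarioCensus.BohrMeter` (the line's `…Lines.BohrMeter` re-homed; docstrings added to the `KY.dot` algebra);
the almost-periodic rows (A1trig / A1apT / A1ap, stubs S2 / M3 / M3trig) are NOT re-homed (in-row displays, files-only).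

No census value is asserted here (the lead books A1F); NS regularity is NOT proved; no summit statement is proved by this file.
-/

noncomputable section

set_option linter.unusedVariables false
set_option linter.dupNamespace false
set_option linter.style.longLine false

namespace Summit.NavierStokesRegularity.NavierStokesRegularity.Theorems.ScenarioCensus.BohrMeter

open Set Function Filter Topology MeasureTheory Finset
open scoped BigOperators
open Literature.Analysis Literature.Analysis.FluidPDE
open Summit.NavierStokesRegularity.NavierStokesRegularity

/-! ## 1. The finite model: the Fourier-side Navier–Stokes system with finitely many modes -/

/-- `|n|²` of a real frequency. -/
def freqSq (n : Fin 3 → ℝ) : ℝ := ∑ i, n i ^ 2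

/-- A bounded ANCIENT solution of the Fourier-side Navier–Stokes system (viscosity `1`) with finite
symmetric Fourier support `S ⊂ ℝ³ ∖ {0}` (no lattice assumption): coefficients `c_n : (−∞,0) → ℂ³`,
real (`c_{−n} = conj c_n`), divergence-free (`n · c_n = 0`), zero off `S`, differentiable, solving
`ċ_n + |n|² c_n + nonlin_n(c) = 0` at EVERY frequency `n ≠ 0` (Kishimoto–Yoneda's (1.3) plus the viscous
term; `KY.nonlin` is the tree's rendering of the projected Euler interaction), and bounded on every past
half-line `(−∞, t₀]`, `t₀ < 0` (the Type-I gauge allows growth as `t → 0⁻`). -/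
structure IsFiniteModeNSAncient (S : Finset (Fin 3 → ℝ)) (c : (Fin 3 → ℝ) → ℝ → (Fin 3 → ℂ)) :
    Prop where
  zero_notMem : (0 : Fin 3 → ℝ) ∉ S
  neg_mem : ∀ n ∈ S, -n ∈ S
  eq_zero_of_notMem : ∀ n ∉ S, ∀ t, c n t = 0
  conj : ∀ n t, c (-n) t = star (c n t)
  div_free : ∀ n ∈ S, ∀ t < 0, KY.dot (KY.cplx n) (c n t) = 0
  differentiableOn : ∀ n, ∀ i : Fin 3, DifferentiableOn ℝ (fun t => c n t i) (Iio 0)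
  ns : ∀ n : Fin 3 → ℝ, n ≠ 0 → ∀ t < 0, ∀ i : Fin 3,
    deriv (fun s => c n s i) t + (freqSq n : ℂ) * c n t i + KY.nonlin S (fun m => c m t) n i = 0
  bounded : ∀ t₀ < 0, ∃ B : ℝ, ∀ n, ∀ t ≤ t₀, ‖c n t‖ ≤ B

/-- **Row A1F** (proposed census row; Fourier side, BOUNDED class, decidable): every bounded ancient
finite-mode solution of the Fourier-side Navier–Stokes system is zero. -/
def Row_A1F : Prop :=
  ∀ (S : Finset (Fin 3 → ℝ)) (c : (Fin 3 → ℝ) → ℝ → (Fin 3 → ℂ)),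
    IsFiniteModeNSAncient S c → ∀ n, ∀ t < 0, c n t = 0

/-- **S1 `FourierEnergyNull`** (obligation; finite algebra): the Euler interaction does no work — for a
real, divergence-free coefficient family with finite symmetric support `S ∌ 0`,
`Re Σ_{n∈S} conj(c_n) · nonlin_n(c) = 0`.  (Reindex the trilinear form
`T = Σ_{n₁+n₂+n₃=0} (c_{n₁}·n₂)(c_{n₂}·c_{n₃})` by `n₂ ↔ n₃` and use `n₃·c… = −n₂·c…` from `nᵢ·c_{nᵢ} = 0`;
the projection `P̂_n` drops out against `conj c_n ⊥ n`.)  Why it might fail: only a bookkeeping slip in the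
rendering of `KY.nonlin` at unoccupied modes (the identity is the Fourier form of `⟨(u·∇)u,u⟩ = 0`). -/
def FourierEnergyNull : Prop :=
  ∀ (S : Finset (Fin 3 → ℝ)) (c : (Fin 3 → ℝ) → (Fin 3 → ℂ)),
    (0 : Fin 3 → ℝ) ∉ S → (∀ n ∈ S, -n ∈ S) → (∀ n ∉ S, c n = 0) → (∀ n, c (-n) = star (c n)) →
      (∀ n ∈ S, KY.dot (KY.cplx n) (c n) = 0) →
        (∑ n ∈ S, ∑ i : Fin 3, (starRingEnd ℂ) (c n i) * KY.nonlin S c n i).re = 0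

/-! ### Algebra of the `ℂ`-bilinear dot product `KY.dot` -/

/-- `KY.dot` is symmetric. [folklore] -/
theorem kyd_comm (a b : Fin 3 → ℂ) : KY.dot a b = KY.dot b a := by
  unfold KY.dot; exact Finset.sum_congr rfl (fun i _ => mul_comm _ _)

/-- `KY.dot` is additive in the second argument. [folklore] -/
theorem kyd_add_right (a v w : Fin 3 → ℂ) : KY.dot a (v + w) = KY.dot a v + KY.dot a w := by
  simp only [KY.dot, Pi.add_apply, mul_add, Finset.sum_add_distrib]

/-- `KY.dot` respects subtraction in the second argument. [folklore] -/
theorem kyd_sub_right (a v w : Fin 3 → ℂ) : KY.dot a (v - w) = KY.dot a v - KY.dot a w := by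
  simp only [KY.dot, Pi.sub_apply, mul_sub, Finset.sum_sub_distrib]

/-- `KY.dot` is homogeneous in the second argument. [folklore] -/
theorem kyd_smul_right (a : Fin 3 → ℂ) (r : ℂ) (v : Fin 3 → ℂ) : KY.dot a (r • v) = r * KY.dot a v := by
  simp only [KY.dot, Pi.smul_apply, smul_eq_mul, Finset.mul_sum]
  exact Finset.sum_congr rfl (fun i _ => by ring)

/-- `KY.dot a 0 = 0`. [folklore] -/
theorem kyd_zero_right (a : Fin 3 → ℂ) : KY.dot a 0 = 0 := by
  simp [KY.dot]

/-- `KY.dot 0 a = 0`. [folklore] -/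
theorem kyd_zero_left (a : Fin 3 → ℂ) : KY.dot 0 a = 0 := by
  simp [KY.dot]

/-- `KY.dot` commutes with finite sums in the second argument. [folklore] -/
theorem kyd_sum_right {ι : Type*} (a : Fin 3 → ℂ) (s : Finset ι) (F : ι → Fin 3 → ℂ) :
    KY.dot a (∑ q ∈ s, F q) = ∑ q ∈ s, KY.dot a (F q) := by
  simp only [KY.dot, Finset.sum_apply, Finset.mul_sum]
  rw [Finset.sum_comm]

/-- `KY.dot` against an `if`-guarded vector. [folklore] -/
theorem kyd_ite_zero (a : Fin 3 → ℂ) (P : Prop) [Decidable P] (v : Fin 3 → ℂ) :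
    KY.dot a (if P then v else 0) = if P then KY.dot a v else 0 := by
  split_ifs
  · rfl
  · exact kyd_zero_right a

/-- `KY.dot a (cplx (−(p+q))) = −KY.dot a (cplx p) − KY.dot a (cplx q)`. [folklore] -/
theorem kyd_cplx_neg_add (a : Fin 3 → ℂ) (p q : Fin 3 → ℝ) :
    KY.dot a (KY.cplx (-(p + q))) = -KY.dot a (KY.cplx p) - KY.dot a (KY.cplx q) := by
  simp only [KY.dot, KY.cplx, Pi.neg_apply, Pi.add_apply, Complex.ofReal_neg, Complex.ofReal_add, mul_neg,
    mul_add, Finset.sum_neg_distrib, Finset.sum_add_distrib]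
  ring

/-- Conjugation of `KY.dot (cplx n) v` for a real frequency `n`. [folklore] -/
theorem star_kyd_cplx (n : Fin 3 → ℝ) (v : Fin 3 → ℂ) :
    star (KY.dot (KY.cplx n) v) = KY.dot (star v) (KY.cplx n) := by
  simp only [KY.dot, KY.cplx, star_sum, star_mul', Complex.star_def, Complex.conj_ofReal, Pi.star_apply]
  exact Finset.sum_congr rfl (fun i _ => mul_comm _ _)

/-- `a ⊥ n` kills the Leray projection `P̂ₙ` inside a dot product. -/
theorem kyd_proj_of_perp (n : Fin 3 → ℝ) (a v : Fin 3 → ℂ) (ha : KY.dot a (KY.cplx n) = 0) :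
    KY.dot a (KY.proj n v) = KY.dot a v := by
  unfold KY.proj
  rw [kyd_sub_right, kyd_smul_right, ha, mul_zero, sub_zero]

/-! ### The trilinear summand and the cancelling involution -/

/-- The basic trilinear summand `(c_p · q) (c_{-(p+q)} · c_q)`. -/
def trilT (c : (Fin 3 → ℝ) → (Fin 3 → ℂ)) (p q : Fin 3 → ℝ) : ℂ :=
  KY.dot (c p) (KY.cplx q) * KY.dot (c (-(p + q))) (c q)

/-- The involution `q ↦ -(p+q)` (where it stays in `S`). -/
def invG (S : Finset (Fin 3 → ℝ)) (p q : Fin 3 → ℝ) : Fin 3 → ℝ :=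
  if -(p + q) ∈ S then -(p + q) else q

/-- The involution on the third frequency, occupied case. [folklore] -/
theorem invG_of_mem {S : Finset (Fin 3 → ℝ)} {p q : Fin 3 → ℝ} (h : -(p + q) ∈ S) : invG S p q = -(p + q) :=
  if_pos h

/-- The involution on the third frequency, unoccupied case. [folklore] -/
theorem invG_of_not_mem {S : Finset (Fin 3 → ℝ)} {p q : Fin 3 → ℝ} (h : -(p + q) ∉ S) : invG S p q = q :=
  if_neg h

/-- `−(p + (−(p+q))) = q`. [folklore] -/
theorem kyd_neg_add_neg_add (p q : Fin 3 → ℝ) : -(p + -(p + q)) = q := by abel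

/-- The trilinear summand vanishes at unoccupied third frequencies. [folklore] -/
theorem trilT_eq_zero_of_not_mem {S : Finset (Fin 3 → ℝ)} {c : (Fin 3 → ℝ) → (Fin 3 → ℂ)}
    (hoff : ∀ n ∉ S, c n = 0) {p q : Fin 3 → ℝ} (h : -(p + q) ∉ S) : trilT c p q = 0 := by
  unfold trilT
  rw [hoff _ h, kyd_zero_left, mul_zero]

/-- Antisymmetry of the trilinear summand under the reindexing `n₂ ↔ n₃`. [folklore] -/
theorem trilT_neg_add {c : (Fin 3 → ℝ) → (Fin 3 → ℂ)} {p : Fin 3 → ℝ}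
    (hdivp : KY.dot (KY.cplx p) (c p) = 0) (q : Fin 3 → ℝ) : trilT c p (-(p + q)) = -trilT c p q := by
  unfold trilT
  rw [kyd_neg_add_neg_add, kyd_cplx_neg_add, kyd_comm (c p) (KY.cplx p), hdivp, neg_zero, zero_sub,
    kyd_comm (c q) (c (-(p + q)))]
  ring

/-- For fixed `p ∈ S`, the inner sum cancels in pairs under `q ↦ -(p+q)`. -/
theorem sum_trilT_eq_zero {S : Finset (Fin 3 → ℝ)} {c : (Fin 3 → ℝ) → (Fin 3 → ℂ)}
    (hoff : ∀ n ∉ S, c n = 0) {p : Fin 3 → ℝ} (hdivp : KY.dot (KY.cplx p) (c p) = 0) :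
    ∑ q ∈ S, trilT c p q = 0 := by
  refine Finset.sum_involution (fun q _ => invG S p q) ?_ ?_ ?_ ?_
  · intro q hq
    by_cases hm : -(p + q) ∈ S
    · rw [invG_of_mem hm, trilT_neg_add hdivp]; ring
    · rw [invG_of_not_mem hm, trilT_eq_zero_of_not_mem hoff hm]; ring
  · intro q hq hne
    by_cases hm : -(p + q) ∈ S
    · rw [invG_of_mem hm]
      intro heq
      apply hne
      have h2 := trilT_neg_add hdivp q
      rw [heq] at h2
      have h3 : (2 : ℂ) * trilT c p q = 0 := by linear_combination h2
      exact (mul_eq_zero.1 h3).resolve_left two_ne_zero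
    · exact absurd (trilT_eq_zero_of_not_mem hoff hm) hne
  · intro q hq
    by_cases hm : -(p + q) ∈ S
    · rw [invG_of_mem hm]; exact hm
    · rw [invG_of_not_mem hm]; exact hq
  · intro q hq
    by_cases hm : -(p + q) ∈ S
    · rw [invG_of_mem hm]
      unfold invG
      rw [kyd_neg_add_neg_add, if_pos hq]
    · rw [invG_of_not_mem hm, invG_of_not_mem hm]

/-- **S1 PROVED (REV 2).**  The Euler interaction does no work on real, divergence-free trigonometric
polynomials: `Re Σ_n conj(c_n)·nonlin_n(c) = 0` (in fact the complex sum itself vanishes). -/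
theorem fourierEnergyNull_holds : FourierEnergyNull := by
  intro S c h0 hsym hoff hconj hdiv
  have hstar : ∀ n, star (c n) = c (-n) := fun n => (hconj n).symm
  -- conj c_n is perpendicular to n (n ∈ S)
  have hperp : ∀ n ∈ S, KY.dot (c (-n)) (KY.cplx n) = 0 := by
    intro n hn
    rw [← hstar n, ← star_kyd_cplx, hdiv n hn, star_zero]
  -- it suffices that the complex sum vanishes
  suffices h : ∑ n ∈ S, ∑ i : Fin 3, (starRingEnd ℂ) (c n i) * KY.nonlin S c n i = 0 by
    rw [h]; simp
  -- name the quadratic sum inside `KY.nonlin`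
  set W : (Fin 3 → ℝ) → (Fin 3 → ℂ) := fun n =>
    ∑ q ∈ S ×ˢ S, (if q.1 + q.2 = n then
      (KY.dot (c q.1) (KY.cplx q.2)) • c q.2 + (KY.dot (c q.2) (KY.cplx q.1)) • c q.1 else 0) with hW
  have hnonlin : ∀ n, KY.nonlin S c n = (Complex.I / 2) • KY.proj n (W n) := by
    intro n; rfl
  -- Step 1: the inner sum is a dot product with `c (-n)` and the projection drops
  have step1 : ∀ n ∈ S, ∑ i : Fin 3, (starRingEnd ℂ) (c n i) * KY.nonlin S c n i =
      (Complex.I / 2) * KY.dot (c (-n)) (W n) := by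
    intro n hn
    have h1 : ∑ i : Fin 3, (starRingEnd ℂ) (c n i) * KY.nonlin S c n i =
        KY.dot (c (-n)) (KY.nonlin S c n) := by
      unfold KY.dot; rw [← hstar n]; rfl
    rw [h1, hnonlin n, kyd_smul_right, kyd_proj_of_perp n _ _ (hperp n hn)]
  rw [Finset.sum_congr rfl step1, ← Finset.mul_sum]
  suffices hT : ∑ n ∈ S, KY.dot (c (-n)) (W n) = 0 by rw [hT, mul_zero]
  -- Step 2: expand `W` inside the dot product
  have step2 : ∀ n ∈ S, KY.dot (c (-n)) (W n) =
      ∑ q ∈ S ×ˢ S, (if q.1 + q.2 = n then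
        KY.dot (c q.1) (KY.cplx q.2) * KY.dot (c (-n)) (c q.2) +
          KY.dot (c q.2) (KY.cplx q.1) * KY.dot (c (-n)) (c q.1) else 0) := by
    intro n hn
    rw [hW, kyd_sum_right]
    refine Finset.sum_congr rfl (fun q _ => ?_)
    rw [kyd_ite_zero]
    split_ifs with h
    · rw [kyd_add_right, kyd_smul_right, kyd_smul_right]
    · rfl
  rw [Finset.sum_congr rfl step2, Finset.sum_comm]
  -- Step 3: the sum over `n` collapses onto `n = q.1 + q.2`
  have step3 : ∀ q ∈ S ×ˢ S, (∑ n ∈ S, if q.1 + q.2 = n then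
        KY.dot (c q.1) (KY.cplx q.2) * KY.dot (c (-n)) (c q.2) +
          KY.dot (c q.2) (KY.cplx q.1) * KY.dot (c (-n)) (c q.1) else 0) =
      trilT c q.1 q.2 + trilT c q.2 q.1 := by
    intro q hq
    by_cases hmem : q.1 + q.2 ∈ S
    · rw [Finset.sum_eq_single_of_mem (q.1 + q.2) hmem (fun n hn hne => if_neg (fun h => hne h.symm)),
        if_pos rfl]
      unfold trilT
      rw [add_comm q.2 q.1]
    · rw [Finset.sum_eq_zero (fun n hn => if_neg (fun h => hmem (by rw [h]; exact hn)))]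
      have hnot : -(q.1 + q.2) ∉ S := by
        intro h; apply hmem; have := hsym _ h; simpa using this
      have hnot' : -(q.2 + q.1) ∉ S := by rwa [add_comm q.2 q.1]
      rw [trilT_eq_zero_of_not_mem hoff hnot, trilT_eq_zero_of_not_mem hoff hnot', add_zero]
  rw [Finset.sum_congr rfl step3, Finset.sum_add_distrib, Finset.sum_product, Finset.sum_product,
    Finset.sum_comm (s := S) (t := S) (f := fun p q => trilT c q p)]
  -- Step 4: both double sums vanish fibrewise
  have key : ∀ p ∈ S, ∑ q ∈ S, trilT c p q = 0 := fun p hp => sum_trilT_eq_zero hoff (hdiv p hp)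
  simp only [Finset.sum_eq_zero key, add_zero]



end Summit.NavierStokesRegularity.NavierStokesRegularity.Theorems.ScenarioCensus.BohrMeter

end
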